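import Summits.AnomalousDissipation.AnomalousDissipation.Theses.KolmogorovLiouville
import Literature.Analysis.FluidPDE.BoundedAnnihilator

/-!
# Crux `SubBallisticLiouville` (stmt-AnomalousDissipation-3018, route KolmogorovLiouville, rank 2) — birth skeleton

`Lines/birth.lean`: the REGULARITY → VORTICITY ANNIHILATION → HARMONIC ENDGAME skeleton of the crux — the
architecture of every proved Liouville theorem of Koch–Nadirashvili–Seregin–Šverák type (KNSS 2009 Thm 5.1:
bounded ⇒ smooth with bounded derivatives; maximum principle kills the vorticity; `curl u = 0`, `div u = 0`,
bounded ⇒ constant by the harmonic Liouville theorem), transplanted to the energy class with INTEGRAL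
sub-ballistic growth. Three named stubs and the kernel-checked composition
`SubBallisticLiouville_of : stub₁ → stub₂ → stub₃ → SubBallisticLiouville` (hypotheses = the name-keyed
aliases `__Registered.stub_*` of the three stub signatures; wiring `example` at the end), concluding the
route decl `Summit.AnomalousDissipation.AnomalousDissipation.Theses.KolmogorovLiouville.SubBallisticLiouville`
BY NAME; sorries only inside the three `stub_*`.

* `stub_localBoundedness` (REGULARITY half; the L²-to-L^∞ step both route reviews singled out): an eternal
  pressure-free energy-class weak solution with L²-oscillation growth `∫_{B_R}|v − ⨍_{B_R}v|² ≤ M R^{3+2h}`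
  (`h < 1`) has POINTWISE sub-ballistic oscillation `‖v(t,x) − ⨍_{B_R}v(t)‖ ≤ C R^{h'}` for a.e.
  `(t,x) ∈ Q_R`, for SOME exponent `h' < 1` (not necessarily `h`: the stub is the weakest that feeds stub 2).
  Large-data, non-perturbative: the NS blow-DOWN `v ↦ λv(λ²·, λ·)` maps growth class `(h, M)` to
  `(h, Mλ^{2+2h})`, so no ε-regularity at scale `R` is available for `h > −1`; the unit-scale estimate
  has to come from the eternal character of `v`.
* `stub_solenoidalAnnihilation` (RIGIDITY half, the heart): with both the integral and the pointwise
  sub-ballistic bounds, the slices `v(t,·)` annihilate every smooth compactly supported divergence-free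
  field for a.e. `t` — the de Rham form of `curl v(t,·) = 0`, stated exactly as the hypothesis `horth` of
  the tree's annihilator lemma `IsWeaklyDivFree.exists_ae_eq_const_of_norm_le_of_forall_integral_inner_eq_zero`
  (KNSS Lemma 3.1 in `L^∞`). In 2-D (KNSS Thm 5.1, LeiZhangZhao2017) and for axisymmetric no-swirl fields
  (KNSS Thm 5.2, PanLi2020 Thm 1.1 with pointwise growth `α < 1`) this is where a scalar maximum principle
  (for `ω`, resp. `ω_θ/r`) with a sublinear divergence-free drift does the work; in full 3-D it contains the
  bounded case of the KNSS conjecture (h' = 0).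
* `stub_annihilatorLiouvilleGrowth` (HARMONIC ENDGAME, known in kind, size M–L): a measurable, locally-L²,
  weakly divergence-free field on `ℝ³` annihilating the solenoidal tests and with L²-oscillation growth
  `≤ M n^{3+2h}` along integer radii `n ≥ n₀`, `h < 1`, is a.e. constant: `w = ∇p` weakly (de Rham),
  `Δp = 0`, so `w` is smooth harmonic, and the interior gradient estimate
  `sup_{B_{n/2}}|∇w| ≲ n⁻¹ (⨍_{B_n}|w − ⨍w|²)^{1/2} ≲ n^{h−1} → 0` replaces boundedness + Liouville. The
  GROWTH version of the tree's bounded annihilator lemma (`BoundedAnnihilator.lean`).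

Composition (`SubBallisticLiouville_of`, no sorry): stub 1 gives `(h', C)`; stub 2 gives annihilation for
a.e. `t`; the energy-class clauses (local `L²` on `B_n × [−n², n²]`, weak divergence-freeness) and the growth
clause are moved under one `∀ᵐ t` by countable intersection over integer radii (`ae_all_iff`), the slices are
a.e.-strongly measurable for a.e. `t` (`AEStronglyMeasurable.prodMk_left` on `volume = volume.prod volume`), and
at such a `t`, with `n₀ := ⌈|t|⌉₊ + 1` (so that `t ∈ [−n², n²]` for `n ≥ n₀`), stub 3 applied to `w = v t`
gives the constant `b(t)`.

Disproof used: none relevant (no `Disproof.lean` / `Negative/` lemma exists for this crux at registration,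
`ledger crux ls stmt-AnomalousDissipation-3018`: no workfiles).
-/

-- `Summit.<Summit>.<Problem>` is the tree's mandated summit-side namespace (CONVENTIONS §2); for this
-- single-conjunct summit the two coincide, so the duplicate is deliberate.
set_option linter.dupNamespace false

noncomputable section

open MeasureTheory TopologicalSpace Set Filter Topology
open scoped ENNReal NNReal

namespace Summit.AnomalousDissipation.AnomalousDissipation.Cruxes.SubBallisticLiouville.Birth

/-- **stub 1 — local boundedness: integral sub-ballistic growth upgrades to pointwise sub-ballistic
oscillation** (the regularity half; size XL). For `h < 1`, every eternal pressure-free energy-class weak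
solution `v` of unforced unit-viscosity Navier–Stokes on `ℝ × ℝ³` (exactly the class of the crux: a.e.
strongly measurable, `L^∞_t L²_x` on every `B_R × [−R², R²]`, weakly divergence-free slices, a weak spatial
gradient in `L²_loc`, the pressure-free weak form against divergence-free space–time tests) whose spatial
`L²`-oscillation obeys `∫_{B_R}|v(t) − ⨍_{B_R}v(t)|² ≤ M R^{3+2h}` for a.e. `|t| ≤ R²`, all `R ≥ 1`, satisfies,
for some exponent `h' < 1` and constant `C`, the POINTWISE bound `‖v(t,x) − ⨍_{B_R}v(t)‖ ≤ C R^{h'}` for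
a.e. `|t| ≤ R²`, a.e. `x ∈ B_R`, all `R ≥ 1`. Why plausibly true: it is implied by the crux itself (a
spatially constant slice has zero oscillation), holds with `h' = h` for caloric fields (parabolic mean value
at scale `R`), and for NS it is the statement that an ETERNAL energy-class solution cannot concentrate its
`L²`-oscillation on sets of small measure scale after scale (local Reynolds number one at the unit scale of
the frame). Why it might fail: energy-class weak solutions carry no local energy inequality, so neither
CKN partial regularity nor Serrin's interior `L^∞` criterion is available; a singular eternal solution in
this class (if NS blows up) would break it. Sources: KochNadirashviliSereginSverak2009 §2–3 (bounded ancient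
mild ⇒ smooth), CaffarelliKohnNirenberg1982, Serrin1962, LemarieRieusset2016 Ch. 13–14. -/
theorem stub_localBoundedness :
    ∀ (h M : ℝ), h < 1 → ∀ v : ℝ → EuclideanSpace ℝ (Fin 3) → EuclideanSpace ℝ (Fin 3), (MeasureTheory.AEStronglyMeasurable (Function.uncurry v) MeasureTheory.volume ∧ (∀ R : ℝ, 0 < R → ∃ C : NNReal, ∀ᵐ t : ℝ, t ∈ Set.Icc (-R ^ 2) (R ^ 2) → ∫⁻ x in Metric.ball (0 : EuclideanSpace ℝ (Fin 3)) (R), ‖v t x‖ₑ ^ 2 ≤ C) ∧ (∀ᵐ t : ℝ, Literature.Analysis.FluidPDE.IsWeaklyDivFree (v t)) ∧ (∃ G : ℝ → EuclideanSpace ℝ (Fin 3) → EuclideanSpace ℝ (Fin 3) →L[ℝ] EuclideanSpace ℝ (Fin 3), Literature.Analysis.FluidPDE.HasWeakSpatialGradientOn (Literature.Analysis.FluidPDE.slab (EuclideanSpace ℝ (Fin 3)) Set.univ isOpen_univ) v G ∧ ∀ R : ℝ, 0 < R → ∫⁻ z in Set.Icc (-R ^ 2) (R ^ 2) ×ˢ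 Metric.ball (0 : EuclideanSpace ℝ (Fin 3)) (R), ENNReal.ofReal (Literature.Analysis.FluidPDE.frobeniusNormSq (G z.1 z.2)) < ⊤) ∧ (∀ ψ : ℝ → EuclideanSpace ℝ (Fin 3) → EuclideanSpace ℝ (Fin 3), Literature.Analysis.FluidPDE.IsSpaceTimeTestOn (Literature.Analysis.FluidPDE.slab (EuclideanSpace ℝ (Fin 3)) Set.univ isOpen_univ) ψ → (∀ t, Literature.Analysis.FluidPDE.VectorCalculus.IsDivFree (ψ t)) → ∫ t, ∫ x, (inner ℝ (v t x) (Literature.Analysis.FluidPDE.timeDeriv ψ t x) + inner ℝ (v t x) (Literature.Analysis.FluidPDE.convect (v t) (ψ t) x) + inner ℝ (v t x) (Laplacian.laplacian (ψ t) x)) = 0)) → (∀ R : ℝ, 1 ≤ R → ∀ᵐ t : ℝ, t ∈ Set.Icc (-R ^ 2) (R ^ 2) → ∫⁻ x in Metric.ball (0 : EuclideanSpace ℝ (Fin 3)) (R), ‖v t x - ⨍ y in Metric.ball (0 : EuclideanSpace ℝ (Fin 3)) (R), v t y‖ₑ ^ 2 ≤ ENNReal.ofReal (M * R ^ (3 +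 2 * h))) → ∃ h' : ℝ, h' < 1 ∧ ∃ C : ℝ, ∀ R : ℝ, 1 ≤ R → ∀ᵐ t : ℝ, t ∈ Set.Icc (-R ^ 2) (R ^ 2) → ∀ᵐ x : EuclideanSpace ℝ (Fin 3), x ∈ Metric.ball (0 : EuclideanSpace ℝ (Fin 3)) R → ‖v t x - ⨍ y in Metric.ball (0 : EuclideanSpace ℝ (Fin 3)) (R), v t y‖ ≤ C * R ^ h' := by
  sorry

/-- **stub 2 — solenoidal annihilation (the vorticity of a sub-ballistic eternal state vanishes)** (the
rigidity half, the heart of the line; size XL, contains the bounded KNSS conjecture at `h' = 0`). For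
`h < 1`, `h' < 1`: an eternal pressure-free energy-class weak solution `v` (the class of the crux) with the
integral growth bound `∫_{B_R}|v(t) − ⨍v(t)|² ≤ M R^{3+2h}` AND the pointwise bound
`‖v(t,x) − ⨍_{B_R}v(t)‖ ≤ C R^{h'}` (a.e. on `Q_R`, `R ≥ 1`, as delivered by stub 1) has, for a.e. `t`,
slices annihilating every smooth compactly supported divergence-free field: `∫ ⟪v(t,x), φ(x)⟫ dx = 0` —
the weak (de Rham) form of `curl v(t,·) = 0`, verbatim the hypothesis `horth` of the tree's
`IsWeaklyDivFree.exists_ae_eq_const_of_norm_le_of_forall_integral_inner_eq_zero`. Why plausibly true: implied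
by the crux (a constant slice pairs to `⟪b, ∫φ⟫ = 0`, `∫φᵢ = ∫div(xᵢφ) = 0`); proved mechanism in 2-D
(vorticity maximum principle with sublinear solenoidal drift: KNSS Thm 5.1, LeiZhangZhao2017) and for
axisymmetric no-swirl fields (`ω_θ/r`: KNSS Thm 5.2; PanLi2020 Thm 1.1 with pointwise growth `α < 1`, sharp
at `α = 1` by the linear strain, Prop 1.5); `h' < 1` is exactly the sublinear-drift threshold of those
proofs. Why it might fail: full 3-D has no scalar obeying a maximum principle (vortex stretching); a bounded
nonconstant eternal mild solution (anti-KNSS) or a Kolmogorov state refutes it — and with it the crux.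
Sources: KochNadirashviliSereginSverak2009 Thm 5.1–5.2 and §1 (conjecture), PanLi2020 Thm 1.1 / Prop 1.5,
LeiZhangZhao2017 (doi:10.1360/n012016-00149), SereginShilkin2018 (survey). -/
theorem stub_solenoidalAnnihilation :
    ∀ (h M h' C : ℝ), h < 1 → h' < 1 → ∀ v : ℝ → EuclideanSpace ℝ (Fin 3) → EuclideanSpace ℝ (Fin 3), (MeasureTheory.AEStronglyMeasurable (Function.uncurry v) MeasureTheory.volume ∧ (∀ R : ℝ, 0 < R → ∃ C : NNReal, ∀ᵐ t : ℝ, t ∈ Set.Icc (-R ^ 2) (R ^ 2) → ∫⁻ x in Metric.ball (0 : EuclideanSpace ℝ (Fin 3)) (R), ‖v t x‖ₑ ^ 2 ≤ C) ∧ (∀ᵐ t : ℝ, Literature.Analysis.FluidPDE.IsWeaklyDivFree (v t)) ∧ (∃ G : ℝ → EuclideanSpace ℝ (Fin 3) → EuclideanSpace ℝ (Fin 3) →L[ℝ] EuclideanSpace ℝ (Fin 3), Literature.Analysis.FluidPDE.HasWeakSpatialGradientOn (Literature.Analysis.FluidPDE.slab (EuclideanSpace ℝ (Fin 3)) Set.univ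 isOpen_univ) v G ∧ ∀ R : ℝ, 0 < R → ∫⁻ z in Set.Icc (-R ^ 2) (R ^ 2) ×ˢ Metric.ball (0 : EuclideanSpace ℝ (Fin 3)) (R), ENNReal.ofReal (Literature.Analysis.FluidPDE.frobeniusNormSq (G z.1 z.2)) < ⊤) ∧ (∀ ψ : ℝ → EuclideanSpace ℝ (Fin 3) → EuclideanSpace ℝ (Fin 3), Literature.Analysis.FluidPDE.IsSpaceTimeTestOn (Literature.Analysis.FluidPDE.slab (EuclideanSpace ℝ (Fin 3)) Set.univ isOpen_univ) ψ → (∀ t, Literature.Analysis.FluidPDE.VectorCalculus.IsDivFree (ψ t)) → ∫ t, ∫ x, (inner ℝ (v t x) (Literature.Analysis.FluidPDE.timeDeriv ψ t x) + inner ℝ (v t x) (Literature.Analysis.FluidPDE.convect (v t) (ψ t) x) + inner ℝ (v t x) (Laplacian.laplacian (ψ t) x)) = 0)) → (∀ R : ℝ, 1 ≤ R → ∀ᵐ t : ℝ, t ∈ Set.Icc (-R ^ 2) (R ^ 2) → ∫⁻ x in Metric.ball (0 : EuclideanSpace ℝ (Fin 3)) (R), ‖v t x - ⨍ y in Metric.ball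 (0 : EuclideanSpace ℝ (Fin 3)) (R), v t y‖ₑ ^ 2 ≤ ENNReal.ofReal (M * R ^ (3 + 2 * h))) → (∀ R : ℝ, 1 ≤ R → ∀ᵐ t : ℝ, t ∈ Set.Icc (-R ^ 2) (R ^ 2) → ∀ᵐ x : EuclideanSpace ℝ (Fin 3), x ∈ Metric.ball (0 : EuclideanSpace ℝ (Fin 3)) R → ‖v t x - ⨍ y in Metric.ball (0 : EuclideanSpace ℝ (Fin 3)) (R), v t y‖ ≤ C * R ^ h') → ∀ᵐ t : ℝ, ∀ φ : EuclideanSpace ℝ (Fin 3) → EuclideanSpace ℝ (Fin 3), Literature.Analysis.FunctionSpaces.IsTestFunctionOn (⊤ : TopologicalSpace.Opens (EuclideanSpace ℝ (Fin 3))) φ → Literature.Analysis.FluidPDE.VectorCalculus.IsDivFree φ → ∫ x, inner ℝ (v t x) (φ x) = 0 := by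
  sorry

/-- **stub 3 — the annihilator Liouville theorem WITH GROWTH (harmonic endgame)** (known in kind; size M–L:
the growth version of the tree's `IsWeaklyDivFree.exists_ae_eq_const_of_norm_le_of_forall_integral_inner_eq_zero`,
which assumes `‖w‖ ≤ M` instead). For `h < 1`: an a.e. strongly measurable field `w : ℝ³ → ℝ³` that is
square-integrable on the balls `B_n`, `n ≥ n₀` (hence locally `L²`), weakly divergence-free, annihilates every
smooth compactly supported divergence-free field, and has `L²`-oscillation growth
`∫_{B_n}|w − ⨍_{B_n}w|² ≤ M n^{3+2h}` along the integer radii `n ≥ n₀`, is a.e. equal to a constant. Why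
true: annihilation of the solenoidal tests makes `w = ∇p` weakly (de Rham / the tree's Helmholtz
annihilator), weak divergence-freeness makes `p`, hence `w`, harmonic and smooth (Weyl), and the interior
gradient estimate for harmonic functions at scale `n`, `sup_{B_{n/2}}|∇w| ≤ (c/n)(⨍_{B_n}|w − ⨍w|²)^{1/2}
≤ c' n^{h−1} → 0` (`h < 1`), forces `∇w ≡ 0` (degree-one harmonic polynomials have exponent exactly
`h = 1`: sharp). Proof route in the tree: mollify as in `BoundedAnnihilator.lean`, replace
`HarmonicOnNhd.apply_eq_apply_of_abs_le` by a mean-value gradient/oscillation estimate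
(`integral_radial_mul_harmonic`). Why it might fail: it should not (classical); only the bookkeeping of
`⨍` on balls and integer radii is delicate. Sources: KochNadirashviliSereginSverak2009 Lemma 3.1,
GilbargTrudinger2001 Thm 2.10 (interior derivative estimates), Evans2010 §2.2.3, LemarieRieusset2016 Thm 4.4. -/
theorem stub_annihilatorLiouvilleGrowth :
    ∀ (h M : ℝ), h < 1 → ∀ w : EuclideanSpace ℝ (Fin 3) → EuclideanSpace ℝ (Fin 3), MeasureTheory.AEStronglyMeasurable w MeasureTheory.volume → (∃ n₀ : ℕ, ∀ n : ℕ, n₀ ≤ n → ∫⁻ x in Metric.ball (0 : EuclideanSpace ℝ (Fin 3)) (n : ℝ), ‖w x‖ₑ ^ 2 < ⊤) → Literature.Analysis.FluidPDE.IsWeaklyDivFree w → (∀ φ : EuclideanSpace ℝ (Fin 3) → EuclideanSpace ℝ (Fin 3), Literature.Analysis.FunctionSpaces.IsTestFunctionOn (⊤ : TopologicalSpace.Opens (EuclideanSpace ℝ (Fin 3))) φ → Literature.Analysis.FluidPDE.VectorCalculus.IsDivFree φ → ∫ x, inner ℝ (w x) (φ x) = 0) → (∃ n₀ : ℕ, ∀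 n : ℕ, n₀ ≤ n → ∫⁻ x in Metric.ball (0 : EuclideanSpace ℝ (Fin 3)) (n : ℝ), ‖w x - ⨍ y in Metric.ball (0 : EuclideanSpace ℝ (Fin 3)) (n : ℝ), w y‖ₑ ^ 2 ≤ ENNReal.ofReal (M * (n : ℝ) ^ (3 + 2 * h))) → ∃ b : EuclideanSpace ℝ (Fin 3), ∀ᵐ x : EuclideanSpace ℝ (Fin 3), w x = b := by
  sorry

/-! ## Name-keyed aliases of the three stub statements — the hypotheses of `SubBallisticLiouville_of`

The native skeleton audit (`#h21_check_skeleton`, run by `ledger skeleton check`) admits a `Prop` hypothesis of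
the composing theorem only if its head constant is a registered obligation or is NAMED like a declared stub;
`__Registered.stub_X` is the statement of `stub_X` verbatim under the stub's short name (device of
`Cruxes/CyclicWindLineLoud/Lines/birth.lean`, `Cruxes/MirrorFloorTG/Lines/birth.lean`). Each alias is an `abbrev`,
definitionally (and textually) its stub's signature. -/
namespace __Registered

/-- Alias of the statement of `stub_localBoundedness` (integral ⇒ pointwise sub-ballistic oscillation), keyed by the stub name. -/
abbrev stub_localBoundedness : Prop :=
  ∀ (h M : ℝ), h < 1 → ∀ v : ℝ → EuclideanSpace ℝ (Fin 3) → EuclideanSpace ℝ (Fin 3), (MeasureTheory.AEStronglyMeasurable (Function.uncurry v) MeasureTheory.volume ∧ (∀ R : ℝ, 0 < R → ∃ C : NNReal, ∀ᵐ t : ℝ, t ∈ Set.Icc (-R ^ 2) (R ^ 2) → ∫⁻ x in Metric.ball (0 : EuclideanSpace ℝ (Fin 3)) (R), ‖v t x‖ₑ ^ 2 ≤ C) ∧ (∀ᵐ t : ℝ, Literature.Analysis.FluidPDE.IsWeaklyDivFree (v t)) ∧ (∃ G : ℝ → EuclideanSpace ℝ (Fin 3) → EuclideanSpace ℝ (Fin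 3) →L[ℝ] EuclideanSpace ℝ (Fin 3), Literature.Analysis.FluidPDE.HasWeakSpatialGradientOn (Literature.Analysis.FluidPDE.slab (EuclideanSpace ℝ (Fin 3)) Set.univ isOpen_univ) v G ∧ ∀ R : ℝ, 0 < R → ∫⁻ z in Set.Icc (-R ^ 2) (R ^ 2) ×ˢ Metric.ball (0 : EuclideanSpace ℝ (Fin 3)) (R), ENNReal.ofReal (Literature.Analysis.FluidPDE.frobeniusNormSq (G z.1 z.2)) < ⊤) ∧ (∀ ψ : ℝ → EuclideanSpace ℝ (Fin 3) → EuclideanSpace ℝ (Fin 3), Literature.Analysis.FluidPDE.IsSpaceTimeTestOn (Literature.Analysis.FluidPDE.slab (EuclideanSpace ℝ (Fin 3)) Set.univ isOpen_univ) ψ → (∀ t, Literature.Analysis.FluidPDE.VectorCalculus.IsDivFree (ψ t)) → ∫ t, ∫ x, (inner ℝ (v t x) (Literature.Analysis.FluidPDE.timeDeriv ψ t x) + inner ℝ (v t x) (Literature.Analysis.FluidPDE.convect (v t) (ψ t) x) + inner ℝ (v t x) (Laplacian.laplacian (ψ t) x)) = 0)) → (∀ R : ℝ, 1 ≤ R →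 ∀ᵐ t : ℝ, t ∈ Set.Icc (-R ^ 2) (R ^ 2) → ∫⁻ x in Metric.ball (0 : EuclideanSpace ℝ (Fin 3)) (R), ‖v t x - ⨍ y in Metric.ball (0 : EuclideanSpace ℝ (Fin 3)) (R), v t y‖ₑ ^ 2 ≤ ENNReal.ofReal (M * R ^ (3 + 2 * h))) → ∃ h' : ℝ, h' < 1 ∧ ∃ C : ℝ, ∀ R : ℝ, 1 ≤ R → ∀ᵐ t : ℝ, t ∈ Set.Icc (-R ^ 2) (R ^ 2) → ∀ᵐ x : EuclideanSpace ℝ (Fin 3), x ∈ Metric.ball (0 : EuclideanSpace ℝ (Fin 3)) R → ‖v t x - ⨍ y in Metric.ball (0 : EuclideanSpace ℝ (Fin 3)) (R), v t y‖ ≤ C * R ^ h'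

/-- Alias of the statement of `stub_solenoidalAnnihilation` (sub-ballistic eternal slices annihilate solenoidal tests), keyed by the stub name. -/
abbrev stub_solenoidalAnnihilation : Prop :=
  ∀ (h M h' C : ℝ), h < 1 → h' < 1 → ∀ v : ℝ → EuclideanSpace ℝ (Fin 3) → EuclideanSpace ℝ (Fin 3), (MeasureTheory.AEStronglyMeasurable (Function.uncurry v) MeasureTheory.volume ∧ (∀ R : ℝ, 0 < R → ∃ C : NNReal, ∀ᵐ t : ℝ, t ∈ Set.Icc (-R ^ 2) (R ^ 2) → ∫⁻ x in Metric.ball (0 : EuclideanSpace ℝ (Fin 3)) (R), ‖v t x‖ₑ ^ 2 ≤ C) ∧ (∀ᵐ t : ℝ, Literature.Analysis.FluidPDE.IsWeaklyDivFree (v t)) ∧ (∃ G : ℝ → EuclideanSpace ℝ (Fin 3) → EuclideanSpace ℝ (Fin 3) →L[ℝ] EuclideanSpace ℝ (Fin 3), Literature.Analysis.FluidPDE.HasWeakSpatialGradientOn (Literature.Analysis.FluidPDE.slab (EuclideanSpace ℝ (Fin 3)) Set.univ isOpen_univ) v G ∧ ∀ R : ℝ, 0 < R → ∫⁻ z in Set.Icc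 (-R ^ 2) (R ^ 2) ×ˢ Metric.ball (0 : EuclideanSpace ℝ (Fin 3)) (R), ENNReal.ofReal (Literature.Analysis.FluidPDE.frobeniusNormSq (G z.1 z.2)) < ⊤) ∧ (∀ ψ : ℝ → EuclideanSpace ℝ (Fin 3) → EuclideanSpace ℝ (Fin 3), Literature.Analysis.FluidPDE.IsSpaceTimeTestOn (Literature.Analysis.FluidPDE.slab (EuclideanSpace ℝ (Fin 3)) Set.univ isOpen_univ) ψ → (∀ t, Literature.Analysis.FluidPDE.VectorCalculus.IsDivFree (ψ t)) → ∫ t, ∫ x, (inner ℝ (v t x) (Literature.Analysis.FluidPDE.timeDeriv ψ t x) + inner ℝ (v t x) (Literature.Analysis.FluidPDE.convect (v t) (ψ t) x) + inner ℝ (v t x) (Laplacian.laplacian (ψ t) x)) = 0)) → (∀ R : ℝ, 1 ≤ R → ∀ᵐ t : ℝ, t ∈ Set.Icc (-R ^ 2) (R ^ 2) → ∫⁻ x in Metric.ball (0 : EuclideanSpace ℝ (Fin 3)) (R), ‖v t x - ⨍ y in Metric.ball (0 : EuclideanSpace ℝ (Fin 3)) (R), v t y‖ₑ ^ 2 ≤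 ENNReal.ofReal (M * R ^ (3 + 2 * h))) → (∀ R : ℝ, 1 ≤ R → ∀ᵐ t : ℝ, t ∈ Set.Icc (-R ^ 2) (R ^ 2) → ∀ᵐ x : EuclideanSpace ℝ (Fin 3), x ∈ Metric.ball (0 : EuclideanSpace ℝ (Fin 3)) R → ‖v t x - ⨍ y in Metric.ball (0 : EuclideanSpace ℝ (Fin 3)) (R), v t y‖ ≤ C * R ^ h') → ∀ᵐ t : ℝ, ∀ φ : EuclideanSpace ℝ (Fin 3) → EuclideanSpace ℝ (Fin 3), Literature.Analysis.FunctionSpaces.IsTestFunctionOn (⊤ : TopologicalSpace.Opens (EuclideanSpace ℝ (Fin 3))) φ → Literature.Analysis.FluidPDE.VectorCalculus.IsDivFree φ → ∫ x, inner ℝ (v t x) (φ x) = 0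

/-- Alias of the statement of `stub_annihilatorLiouvilleGrowth` (annihilator Liouville theorem with growth), keyed by the stub name. -/
abbrev stub_annihilatorLiouvilleGrowth : Prop :=
  ∀ (h M : ℝ), h < 1 → ∀ w : EuclideanSpace ℝ (Fin 3) → EuclideanSpace ℝ (Fin 3), MeasureTheory.AEStronglyMeasurable w MeasureTheory.volume → (∃ n₀ : ℕ, ∀ n : ℕ, n₀ ≤ n → ∫⁻ x in Metric.ball (0 : EuclideanSpace ℝ (Fin 3)) (n : ℝ), ‖w x‖ₑ ^ 2 < ⊤) → Literature.Analysis.FluidPDE.IsWeaklyDivFree w → (∀ φ : EuclideanSpace ℝ (Fin 3) → EuclideanSpace ℝ (Fin 3), Literature.Analysis.FunctionSpaces.IsTestFunctionOn (⊤ : TopologicalSpace.Opens (EuclideanSpace ℝ (Fin 3))) φ → Literature.Analysis.FluidPDE.VectorCalculus.IsDivFree φ → ∫ x, inner ℝ (w x) (φ x) = 0) → (∃ n₀ : ℕ, ∀ n : ℕ, n₀ ≤ n → ∫⁻ x in Metric.ball (0 : EuclideanSpace ℝ (Fin 3)) (n : ℝ), ‖w x - ⨍ y in Metric.ball (0 :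 EuclideanSpace ℝ (Fin 3)) (n : ℝ), w y‖ₑ ^ 2 ≤ ENNReal.ofReal (M * (n : ℝ) ^ (3 + 2 * h))) → ∃ b : EuclideanSpace ℝ (Fin 3), ∀ᵐ x : EuclideanSpace ℝ (Fin 3), w x = b

end __Registered

/-- **Composition** (kernel-checked, no `sorry` of its own): the three stub statements (as the name-keyed
aliases `__Registered.stub_*`) imply the crux
`Summit.AnomalousDissipation.AnomalousDissipation.Theses.KolmogorovLiouville.SubBallisticLiouville` BY NAME.
Stub 1 ⇒ pointwise exponent `h' < 1` and constant `C`; stub 2 ⇒ annihilation of the solenoidal tests for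
a.e. `t`; countable intersection over integer radii (`ae_all_iff`) puts the local-`L²`, divergence-free and
growth clauses under one `∀ᵐ t`, slices are a.e.-strongly measurable for a.e. `t` (`prodMk_left`), and at
such a `t`, with `n₀ = ⌈|t|⌉₊ + 1`, stub 3 at `w = v t` yields the constant. [folklore] -/
theorem SubBallisticLiouville_of :
    __Registered.stub_localBoundedness → __Registered.stub_solenoidalAnnihilation →
      __Registered.stub_annihilatorLiouvilleGrowth →
        Summit.AnomalousDissipation.AnomalousDissipation.Theses.KolmogorovLiouville.SubBallisticLiouville := by
  intro hLB hSA hAL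
  dsimp only [__Registered.stub_localBoundedness, __Registered.stub_solenoidalAnnihilation,
    __Registered.stub_annihilatorLiouvilleGrowth] at hLB hSA hAL
  intro h M hh v hv hg
  -- stub 1: pointwise sub-ballistic oscillation with some exponent h' < 1
  obtain ⟨h', hh', C, hC⟩ := hLB h M hh v hv hg
  -- stub 2: the slices annihilate the solenoidal tests, for a.e. t
  have hann := hSA h M h' C hh hh' v hv hg hC
  obtain ⟨hmeas, hL2, hdiv, -, -⟩ := hv
  -- slices are a.e.-strongly measurable for a.e. t
  have hslice : ∀ᵐ t : ℝ, MeasureTheory.AEStronglyMeasurable (v t) MeasureTheory.volume := by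
    have hmeas' : MeasureTheory.AEStronglyMeasurable (Function.uncurry v)
        ((MeasureTheory.volume : Measure ℝ).prod (MeasureTheory.volume : Measure (EuclideanSpace ℝ (Fin 3)))) := by
      simpa [MeasureTheory.Measure.volume_eq_prod] using hmeas
    simpa [Function.uncurry] using hmeas'.prodMk_left
  -- local L² on B_n × [-n², n²], all integer radii at once
  have hL2n : ∀ n : ℕ, ∀ᵐ t : ℝ, (1 : ℝ) ≤ n → t ∈ Set.Icc (-(n : ℝ) ^ 2) ((n : ℝ) ^ 2) →
      ∫⁻ x in Metric.ball (0 : EuclideanSpace ℝ (Fin 3)) (n : ℝ), ‖v t x‖ₑ ^ 2 < ⊤ := by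
    intro n
    by_cases hn : (1 : ℝ) ≤ n
    · obtain ⟨Cn, hCn⟩ := hL2 (n : ℝ) (by linarith)
      filter_upwards [hCn] with t ht _ htI
      exact lt_of_le_of_lt (ht htI) ENNReal.coe_lt_top
    · exact Filter.Eventually.of_forall fun t h1 => absurd h1 hn
  have hL2all := MeasureTheory.ae_all_iff.2 hL2n
  -- growth on B_n, all integer radii at once
  have hgn : ∀ n : ℕ, ∀ᵐ t : ℝ, (1 : ℝ) ≤ n → t ∈ Set.Icc (-(n : ℝ) ^ 2) ((n : ℝ) ^ 2) →
      ∫⁻ x in Metric.ball (0 : EuclideanSpace ℝ (Fin 3)) (n : ℝ), ‖v t x - ⨍ y in Metric.ball (0 : EuclideanSpace ℝ (Fin 3)) (n : ℝ), v t y‖ₑ ^ 2 ≤ ENNReal.ofReal (M * (n : ℝ) ^ (3 + 2 * h)) := by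
    intro n
    by_cases hn : (1 : ℝ) ≤ n
    · filter_upwards [hg (n : ℝ) hn] with t ht _ htI
      exact ht htI
    · exact Filter.Eventually.of_forall fun t h1 => absurd h1 hn
  have hgall := MeasureTheory.ae_all_iff.2 hgn
  filter_upwards [hann, hdiv, hslice, hL2all, hgall] with t ht_ann ht_div ht_meas ht_L2 ht_g
  -- integer radius threshold n₀ = ⌈|t|⌉₊ + 1: for n ≥ n₀, 1 ≤ n and t ∈ [-n², n²]
  set n₀ : ℕ := ⌈|t|⌉₊ + 1 with hn₀
  have hn₀1 : ∀ n : ℕ, n₀ ≤ n → (1 : ℝ) ≤ n := fun n hn => by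
    have : (1 : ℕ) ≤ n := le_trans (Nat.le_add_left 1 _) hn
    exact_mod_cast this
  have hn₀t : ∀ n : ℕ, n₀ ≤ n → t ∈ Set.Icc (-(n : ℝ) ^ 2) ((n : ℝ) ^ 2) := fun n hn => by
    have h1 : (1 : ℝ) ≤ n := hn₀1 n hn
    have hceil : |t| ≤ (⌈|t|⌉₊ : ℝ) := Nat.le_ceil _
    have hcast : ((⌈|t|⌉₊ + 1 : ℕ) : ℝ) ≤ (n : ℝ) := by exact_mod_cast hn
    have habs : |t| ≤ (n : ℝ) := by push_cast at hcast; linarith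
    have hsq : (n : ℝ) ≤ (n : ℝ) ^ 2 := by nlinarith
    constructor
    · have := neg_abs_le t
      linarith
    · have := le_abs_self t
      linarith
  exact hAL h M hh (v t) ht_meas ⟨n₀, fun n hn => ht_L2 n (hn₀1 n hn) (hn₀t n hn)⟩ ht_div ht_ann
    ⟨n₀, fun n hn => ht_g n (hn₀1 n hn) (hn₀t n hn)⟩

/-- WIRING CHECK: the three sorried stubs compose to a closed term of the crux's type (modulo their `sorry`s).
Deliberately an `example` (no constant enters the environment), so that a BC3 probe importing this file could not
close `stub → SubBallisticLiouville` by `exact?` through a pre-composed witness. -/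
example : Summit.AnomalousDissipation.AnomalousDissipation.Theses.KolmogorovLiouville.SubBallisticLiouville :=
  SubBallisticLiouville_of stub_localBoundedness stub_solenoidalAnnihilation stub_annihilatorLiouvilleGrowth

end Summit.AnomalousDissipation.AnomalousDissipation.Cruxes.SubBallisticLiouville.Birth

end
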